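import Mathlib
import HarnessLib
import Summits.FinalStateConjecture.FinalStateConjecture.Statement
import Summits.FinalStateConjecture.FinalStateConjecture.Theorems.StarvedNecksSeamedChartsExhaustRide
import Literature.Geometry.Lorentzian.KerrConvergence
import Literature.Geometry.Lorentzian.KerrWaveEnergy
import Literature.Geometry.Lorentzian.HypersurfaceRestriction
import Literature.Uncategorized.HonestCore
import Literature.Uncategorized.OrientationAnchor
import Summits.FinalStateConjecture.FinalStateConjecture.Theorems.StarvedNecksNeckGapDecayStubOrientationAnchorPastRay

/-!
# S2 — orientation anchor of the input hole charts
# (crux `StarvedNecks.NeckGapDecay`, stmt-FinalStateConjecture-16768, line `Sketch`,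
# registered stub `stub_orientationAnchor`)

For an admissible datum, an MGHD `𝒟`, a `C⁴` final-state decomposition `d` of
`O = exteriorOf 𝒟 d.charted = J⁺(ι X) ∩ I⁻(d.charted)` with `HonestCore(d, R₀)`: for every hole `i`
and radius `R` there is a chart time `T` after which, on the shell `{T ≤ tᵢ, R₀ ≤ rᵢ ≤ R}` of the
boosted Kerr domain, the push-forward `dΨᵢ(Λᵢe₀)` of the label's time axis under the INPUT hole
chart `Ψᵢ = d.chart i` is future-directed.

Proof (global Lorentzian causality, no shell connectivity needed).
1. Fixed-radius `C⁴ ⊇ C⁰` convergence (`d.tendsto_truncDeviationCk i R`) gives a time `T₁` after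
   which `‖(Ψᵢ^* g − g_B)(y)‖ ≤ 1/(20(‖Λᵢ‖² + 1))` at every `y` with `T₁ ≤ t y`, `r y ≤ R`; with
   `r y ≥ R₀ ≥ 100 Mᵢ` the cone algebra gives `g(dΨ Λe₀, dΨ Λe₀) ≤ −1 + 2/100 + 1/20 ≤ −9/10`
   (`val_mfderiv_axis_le_of_norm_deviation_le`).
2. At a shell point `x` with `t x ≥ T := max T₁ (τ₀ + 1)` the vector is timelike, hence future- or
   past-directed. If it were past-directed, lift the coordinate ray `s ↦ x + s Λᵢe₀` (`s ≥ 0`; it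
   stays in the domain with `r = r x`, `t = t x + s`) to `γ = Ψᵢ ∘ ray`: `g(γ', γ') ≤ −9/10`, and the
   continuous, nowhere vanishing `g(T, γ')` keeps its sign, so `γ` is a past-directed uniformly
   timelike ray inside `Ψᵢ(late region) ⊆ O ⊆ J⁺(ι X)`.
3. Such a ray is impossible: `false_of_pastRay_subset_causalFuture` (helper file
   `StarvedNecksNeckGapDecayStubOrientationAnchorPastRay.lean`: future endless for `−T`, eventually in
   `J⁻(ι X)`, push-up into `I⁺(ι X)`, against `J⁻(ι X) ∩ I⁺(ι X) = ∅`).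

File map: the registered statement (`HonestCore`, `OrientationAnchor`, `OrientationAnchorHolds`, verbatim
from the skeleton); the Cauchy obstruction `false_of_pastRay_subset_causalFuture` (generic time-oriented
Lorentzian manifolds); the lift `line_lift` of a straight chart line under a chart map; pointwise `C⁰`
extraction and the cone algebra on a boosted Kerr background; the coordinate ray `y + s Λe₀` (on top of
the landed ride kinematics `poincareInv_add_smul`, `radius_add_smul_e₀`); the chart-level theorem
`exists_forall_isFutureDirected_axis`; the stub `stub_orientationAnchor`.

References: B. O'Neill, *Semi-Riemannian geometry*, 1983, Ch. 5, Lemma 5.26, p. 145; Ch. 14, Cor. 14.1,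
Def. 14.28, Lemma 14.29; M. Visser, arXiv:0706.0622, (32)–(35); DHRT arXiv:2104.08222, §1.
-/

noncomputable section

open scoped Manifold ContDiff Topology ENNReal
open Filter Set MeasureTheory Topology Literature.Geometry.Lorentzian Literature.Uncategorized
open Summit.FinalStateConjecture.FinalStateConjecture.Theorems.SeamedChartsExhaust.WideAnchoring
  (poincareInv_add_smul radius_add_smul_e₀)

namespace Summit.FinalStateConjecture.FinalStateConjecture.Theorems.NeckGapDecay.ConnectionLevelCones.OrientationAnchorStub
set_option linter.dupNamespace false

/-! ## The registered statement (verbatim from the skeleton `Lines/Sketch.lean`; its hypothesis bundle `HonestCore` and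
its conclusion predicate `OrientationAnchor`, verbatim the skeleton's, are the Literature-level
`Literature.Uncategorized.HonestCore` / `Literature.Uncategorized.OrientationAnchor`) -/

/-- **S2 — orientation anchor of the input hole charts** (G4's sign; global): for every admissible datum, MGHD,
`C⁴` decomposition `d` of `O = exteriorOf 𝒟 d.charted` with `HonestCore(d, R₀)`, `OrientationAnchor` holds.
The registered stub statement of the line skeleton `Cruxes/NeckGapDecay/Lines/Sketch.lean`, verbatim; it is a
Summit-level statement (it mentions `exteriorOf` of `Summits.FinalStateConjecture…Statement`), hence declared here
and not under `Literature/` (its Literature-level ingredients are `Literature.Uncategorized.HonestCore` /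
`.OrientationAnchor`); proved below (`stub_orientationAnchor`). -/
def OrientationAnchorHolds : Prop :=
  ∀ (X : Type) [TopologicalSpace X] [ChartedSpace E3 X] [IsManifold (𝓡 3) ∞ X] [ConnectedSpace X]
    (D : InitialDataSet (𝓡 3) X), D ∈ admissibleVacuumData X →
    ∀ 𝒟 : VacuumCauchyDevelopment D, 𝒟.IsMaximal →
    ∀ (O : Set 𝒟.carrier) (d : FinalStateDecomposition 𝒟.toSpacetime O 4) (R₀ : ℝ),
      O = exteriorOf 𝒟.toCauchyDevelopment d.charted →
      HonestCore 𝒟.toSpacetime O 4 d R₀ → OrientationAnchor 𝒟.toSpacetime O 4 d R₀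

/-! ## Regularity side conditions -/

/-- `2 ≤ ∞` in `ℕ∞ω` (regularity side condition of the causality theorems). [folklore] -/
private lemma two_le_infty : (2 : ℕ∞ω) ≤ (∞ : ℕ∞ω) := WithTop.coe_le_coe.mpr le_top
/-- `1 ≤ ∞` in `ℕ∞ω`. [folklore] -/
private lemma one_le_infty : (1 : ℕ∞ω) ≤ (∞ : ℕ∞ω) := WithTop.coe_le_coe.mpr le_top

/-! ## Curves: the lift of a straight chart line under a chart map -/

/-- The straight chart line `s ↦ x₀ + s • v` of `E4` has derivative `v`. [folklore] -/
private theorem hasDerivAt_line (x₀ v : E4) (t : ℝ) :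
    HasDerivAt (fun s : ℝ ↦ x₀ + s • v) v t := by
  simpa using ((hasDerivAt_id t).smul_const v).const_add x₀

/-- The velocity of the straight chart line (as a curve in the manifold `E4`) is `v`. [folklore] -/
private theorem velocity_line (x₀ v : E4) (t : ℝ) :
    velocity 𝓘(ℝ, E4) (fun s : ℝ ↦ x₀ + s • v) t = v := by
  -- adapted from `velocity_vert` (ClusterCompletenessRecurrentlyFlatDispersesStubChartFuture)
  simp only [velocity]
  rw [mfderiv_eq_fderiv, ← toSpanSingleton_deriv, (hasDerivAt_line x₀ v t).deriv]
  exact one_smul ℝ _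

/-- Chain rule for velocities: `(f ∘ γ)'(t) = df_{γ t}(γ' t)`. [folklore] -/
private theorem velocity_comp' {E' : Type*} [NormedAddCommGroup E'] [NormedSpace ℝ E']
    {H' : Type*} [TopologicalSpace H'] {I' : ModelWithCorners ℝ E' H'} {N : Type*}
    [TopologicalSpace N] [ChartedSpace H' N]
    {E : Type*} [NormedAddCommGroup E] [NormedSpace ℝ E] {H : Type*} [TopologicalSpace H]
    {I : ModelWithCorners ℝ E H} {M : Type*} [TopologicalSpace M] [ChartedSpace H M]
    {f : N → M} {γ : ℝ → N} {t : ℝ} (hf : MDifferentiableAt I' I f (γ t))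
    (hγ : MDifferentiableAt 𝓘(ℝ, ℝ) I' γ t) :
    velocity I (f ∘ γ) t = mfderiv I' I f (γ t) (velocity I' γ t) := by
  simp only [velocity]
  rw [mfderiv_comp t hf hγ]
  rfl

/-- **The lifted straight line and its velocity.** For a smooth chart map `Ψ : U₀ → 𝓢` on an open
`U₀ ⊆ E4` and a curve `c : ℝ → U₀` whose underlying `E4`-curve is the straight line `s ↦ x₀ + s • v`,
the lift `Ψ ∘ c` is smooth and its velocity at `t` is `dΨ_{c t}(v)` (chain rule; the inclusion
`U₀ ↪ E4` has identity differential, `mfderiv_subtypeVal`). [folklore] -/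
theorem line_lift {𝓢 : Spacetime.{0} 4} {U₀ : TopologicalSpace.Opens E4}
    {Ψ : U₀ → 𝓢.carrier} (hΨ : ContMDiff 𝓘(ℝ, E4) (𝓡 4) ∞ Ψ) (x₀ v : E4) {c : ℝ → U₀}
    (hc : ∀ s : ℝ, (c s : E4) = x₀ + s • v) :
    ContMDiff 𝓘(ℝ, ℝ) (𝓡 4) ∞ (Ψ ∘ c) ∧ ∀ t : ℝ, MDifferentiableAt 𝓘(ℝ, ℝ) (𝓡 4) (Ψ ∘ c) t ∧
      velocity (𝓡 4) (Ψ ∘ c) t = mfderiv 𝓘(ℝ, E4) (𝓡 4) Ψ (c t) v := by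
  -- adapted from `vertical_lift` (ClusterCompletenessRecurrentlyFlatDispersesStubChartFuture)
  have hcv : Subtype.val ∘ c = (fun s : ℝ ↦ x₀ + s • v) := funext hc
  have hp_smooth : ContMDiff 𝓘(ℝ, ℝ) 𝓘(ℝ, E4) ∞ (fun s : ℝ ↦ x₀ + s • v) :=
    contMDiff_iff_contDiff.mpr (contDiff_const.add (contDiff_id.smul contDiff_const))
  have hc_smooth : ContMDiff 𝓘(ℝ, ℝ) 𝓘(ℝ, E4) ∞ c :=
    (ContMDiff.subtypeVal_comp_iff U₀ c).mp (hcv ▸ hp_smooth)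
  have hγ : ContMDiff 𝓘(ℝ, ℝ) (𝓡 4) ∞ (Ψ ∘ c) := hΨ.comp hc_smooth
  refine ⟨hγ, fun t ↦ ⟨hγ.mdifferentiableAt (by simp), ?_⟩⟩
  have hct : MDifferentiableAt 𝓘(ℝ, ℝ) 𝓘(ℝ, E4) c t := hc_smooth.mdifferentiableAt (by simp)
  have hΨt : MDifferentiableAt 𝓘(ℝ, E4) (𝓡 4) Ψ (c t) := hΨ.mdifferentiableAt (by simp)
  -- velocity of `c` = velocity of the `E4`-line (identity differential of the inclusion)
  have hvc : velocity 𝓘(ℝ, E4) c t = v := by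
    have h1 : velocity 𝓘(ℝ, E4) (Subtype.val ∘ c) t =
        mfderiv 𝓘(ℝ, E4) 𝓘(ℝ, E4) (Subtype.val : U₀ → E4) (c t) (velocity 𝓘(ℝ, E4) c t) :=
      velocity_comp' (hasMFDerivAt_subtypeVal (c t)).mdifferentiableAt hct
    rw [mfderiv_subtypeVal, hcv, velocity_line] at h1
    exact h1.symm
  rw [velocity_comp' hΨt hct, hvc]

/-! ## Pointwise extraction and cone algebra on a boosted Kerr background -/

/-- **Pointwise `C⁰` bound from the truncated `Cᵏ` deviation.** If `truncDeviationCk B Ψ k ρ τ ≤ δ`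
(`0 ≤ δ`), then `‖(Ψ^* g − g_B)(x)‖ ≤ δ` at every point `x` of the truncated slab `{t = τ, r ≤ ρ}`:
the `m = 0` term of the `Cᵏ` sup norm at `x` is `‖deviation x‖` (`norm_iteratedFDeriv_zero`,
`deviationExtend_coe`). DHRT arXiv:2104.08222, §1. [folklore] -/
theorem norm_deviation_le_of_truncDeviationCk_le (𝓢 : Spacetime.{0} 4) (B : ModelBackground)
    (Ψ : B.domain → 𝓢.carrier) {k : ℕ} {ρ τ δ : ℝ} (hδ : 0 ≤ δ)
    (h : 𝓢.truncDeviationCk B Ψ k ρ τ ≤ ENNReal.ofReal δ)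
    (x : B.domain) (hx : x ∈ B.truncTimeSlab ρ τ) :
    ‖𝓢.deviation B Ψ x‖ ≤ δ := by
  -- adapted from `stub_pointwiseDeviation` (StarvedNecksFutureOrientedOfSeamedStubPointwiseDeviation)
  have hmem : x.1 ∈ Subtype.val '' B.truncTimeSlab ρ τ := mem_image_of_mem _ hx
  have h1 := enorm_iteratedFDeriv_le_supCkENorm (Nat.zero_le k) hmem (𝓢.deviationExtend B Ψ)
  have h2 : ‖iteratedFDeriv ℝ 0 (𝓢.deviationExtend B Ψ) x.1‖ₑ ≤ ENNReal.ofReal δ := h1.trans h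
  rw [← ofReal_norm, norm_iteratedFDeriv_zero, Spacetime.deviationExtend_coe,
    ENNReal.ofReal_le_ofReal_iff hδ] at h2
  exact h2

/-- **Quantitative timelikeness of the label axis under small deviation** (pointwise cone algebra):
on a boosted Kerr background with `0 ≤ M`, at a point with `100 M ≤ r` where the pulled-back metric
deviates from the model by at most `1/(20(‖Λ‖² + 1))` in operator norm,
`g(dΨ Λe₀, dΨ Λe₀) = g_{M,a}(e₀, e₀) + dev ≤ (−1 + 2H) + ‖dev‖‖Λ‖² ≤ −1 + 1/50 + 1/20 ≤ −9/10`
(`H ≤ M/r ≤ 1/100`). O'Neill 1983, Ch. 5, Lemma 5.26; Visser arXiv:0706.0622, (32)–(35). [folklore] -/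
theorem val_mfderiv_axis_le_of_norm_deviation_le (𝓢 : Spacetime.{0} 4) (Λ : lorentzGroup) (c : E4)
    {M : ℝ} (a : ℝ) (hM : 0 ≤ M) (Ψ : (boostedKerrBackground Λ c M a).domain → 𝓢.carrier)
    (x : (boostedKerrBackground Λ c M a).domain)
    (hr : 100 * M ≤ (boostedKerrBackground Λ c M a).radius x.1)
    (hdev : ‖𝓢.deviation (boostedKerrBackground Λ c M a) Ψ x‖ ≤
      1 / (20 * (‖((Λ : E4 ≃L[ℝ] E4) : E4 →L[ℝ] E4)‖ ^ 2 + 1))) :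
    𝓢.metric.val (Ψ x) (mfderiv 𝓘(ℝ, E4) (𝓡 4) Ψ x ((Λ : E4 ≃L[ℝ] E4) (E4.basisVector 0)))
      (mfderiv 𝓘(ℝ, E4) (𝓡 4) Ψ x ((Λ : E4 ≃L[ℝ] E4) (E4.basisVector 0))) ≤ -(9 / 10) := by
  -- adapted from the skeleton's `isTimelike_mfderiv_axis_of_norm_deviation_le` (Lines/Sketch.lean),
  -- keeping the quantitative conclusion; the bound `1/(20(‖Λ‖² + 1))` avoids `‖Λ‖ > 0`
  have hK0 : 0 ≤ ‖((Λ : E4 ≃L[ℝ] E4) : E4 →L[ℝ] E4)‖ := norm_nonneg _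
  have hx' : 0 < Kerr.radius a (poincareInv Λ c x.1) := Kerr.radius_pos_of_mem_region x.2
  -- model value: `g_B(x)(Λe₀, Λe₀) = g_{M,a}(x')(e₀, e₀) = -1 + 2H(x')`
  have hmodel : (boostedKerrBackground Λ c M a).bilin x.1 ((Λ : E4 ≃L[ℝ] E4) (E4.basisVector 0))
      ((Λ : E4 ≃L[ℝ] E4) (E4.basisVector 0)) = -1 + 2 * Kerr.scalarH M a (poincareInv Λ c x.1) := by
    show boostedKerrBilin Λ c M a x.1 _ _ = _
    rw [boostedKerrBilin_apply, ContinuousLinearEquiv.symm_apply_apply, Kerr.bilin_apply,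
      Minkowski.bilin_basisVector_zero, Kerr.nullCovector_basisVector_zero]
    ring
  -- `H ≤ M/r ≤ 1/100`
  have hH : Kerr.scalarH M a (poincareInv Λ c x.1) ≤ 1 / 100 := by
    have h1 := Kerr.scalarH_le_div hM a hx'
    have hr' : 100 * M ≤ Kerr.radius a (poincareInv Λ c x.1) := hr
    calc Kerr.scalarH M a (poincareInv Λ c x.1) ≤ M / Kerr.radius a (poincareInv Λ c x.1) := h1
      _ ≤ 1 / 100 := by
          rw [div_le_div_iff₀ hx' (by norm_num : (0 : ℝ) < 100)]
          linarith
  -- deviation value bounded by `‖dev‖ ‖Λe₀‖² ≤ ‖Λ‖² / (20 (‖Λ‖² + 1)) ≤ 1/20`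
  have hvn : ‖(Λ : E4 ≃L[ℝ] E4) (E4.basisVector 0)‖ ≤ ‖((Λ : E4 ≃L[ℝ] E4) : E4 →L[ℝ] E4)‖ := by
    have h := ((Λ : E4 ≃L[ℝ] E4) : E4 →L[ℝ] E4).le_opNorm (E4.basisVector 0)
    have h1 : ‖(E4.basisVector 0 : E4)‖ = 1 := by simp
    rw [h1, mul_one] at h
    exact h
  have hdv : 𝓢.deviation (boostedKerrBackground Λ c M a) Ψ x ((Λ : E4 ≃L[ℝ] E4) (E4.basisVector 0))
      ((Λ : E4 ≃L[ℝ] E4) (E4.basisVector 0)) ≤ 1 / 20 := by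
    have hD := hdev
    generalize hDev : 𝓢.deviation (boostedKerrBackground Λ c M a) Ψ x = Dv at hD ⊢
    generalize hV : (Λ : E4 ≃L[ℝ] E4) (E4.basisVector 0) = v at hvn ⊢
    generalize hK : ‖((Λ : E4 ≃L[ℝ] E4) : E4 →L[ℝ] E4)‖ = K at hK0 hvn hD ⊢
    have h0 : ‖Dv v v‖ ≤ ‖Dv‖ * ‖v‖ * ‖v‖ :=
      ((Dv v).le_opNorm v).trans (mul_le_mul_of_nonneg_right (Dv.le_opNorm v) (norm_nonneg v))
    have h1 : Dv v v ≤ ‖Dv‖ * ‖v‖ * ‖v‖ := (Real.le_norm_self _).trans h0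
    have hvnn : 0 ≤ ‖v‖ := norm_nonneg v
    have hdnn : 0 ≤ ‖Dv‖ := norm_nonneg Dv
    have h2 : ‖Dv‖ * ‖v‖ * ‖v‖ ≤ ‖Dv‖ * K * K := by
      have := mul_le_mul hvn hvn hvnn hK0
      nlinarith
    have h3 : ‖Dv‖ * K * K ≤ 1 / (20 * (K ^ 2 + 1)) * K * K := by
      have hKK : 0 ≤ K * K := mul_nonneg hK0 hK0
      nlinarith [mul_le_mul_of_nonneg_right hD hKK]
    have h4 : 1 / (20 * (K ^ 2 + 1)) * K * K ≤ 1 / 20 := by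
      have hpos : (0 : ℝ) < 20 * (K ^ 2 + 1) := by positivity
      rw [show 1 / (20 * (K ^ 2 + 1)) * K * K = K ^ 2 / (20 * (K ^ 2 + 1)) by ring,
        div_le_div_iff₀ hpos (by norm_num : (0 : ℝ) < 20)]
      nlinarith [sq_nonneg K]
    linarith
  have happ := 𝓢.deviation_apply (boostedKerrBackground Λ c M a) Ψ x ((Λ : E4 ≃L[ℝ] E4) (E4.basisVector 0))
    ((Λ : E4 ≃L[ℝ] E4) (E4.basisVector 0))
  linarith

/-! ## The coordinate ray `s ↦ y + s Λe₀` of a boosted Kerr background -/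

section Chart

variable (Λ : lorentzGroup) (c : E4) (M a : ℝ)

/-- Chart time grows linearly along the label's time axis: `t(y + s Λe₀) = t(y) + s`. [folklore] -/
theorem time_add_smul_axis (y : E4) (s : ℝ) :
    (boostedKerrBackground Λ c M a).time (y + s • (Λ : E4 ≃L[ℝ] E4) (E4.basisVector 0)) =
      (boostedKerrBackground Λ c M a).time y + s := by
  show poincareInv Λ c _ 0 = poincareInv Λ c y 0 + s
  rw [poincareInv_add_smul]
  simp [E4.basisVector]

/-- The rest-frame radius is constant along the label's time axis: `r(y + s Λe₀) = r(y)`. [folklore] -/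
theorem radius_add_smul_axis (y : E4) (s : ℝ) :
    (boostedKerrBackground Λ c M a).radius (y + s • (Λ : E4 ≃L[ℝ] E4) (E4.basisVector 0)) =
      (boostedKerrBackground Λ c M a).radius y := by
  show Kerr.radius a (poincareInv Λ c _) = Kerr.radius a (poincareInv Λ c y)
  rw [poincareInv_add_smul, radius_add_smul_e₀]

/-- The boosted Kerr domain is invariant along the label's time axis (its membership condition is a
condition on the rest-frame radius). [folklore] -/
theorem mem_domain_add_smul_axis {y : E4} (hy : y ∈ (boostedKerrBackground Λ c M a).domain) (s : ℝ) :
    y + s • (Λ : E4 ≃L[ℝ] E4) (E4.basisVector 0) ∈ (boostedKerrBackground Λ c M a).domain := by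
  have hy' : max (Kerr.rPlus M a) 0 < Kerr.radius a (poincareInv Λ c y) := hy
  show max (Kerr.rPlus M a) 0 < Kerr.radius a (poincareInv Λ c _)
  rwa [poincareInv_add_smul, radius_add_smul_e₀]

/-! ## The chart-level theorem -/

/-- **Orientation anchor, chart level.** Let `𝓢` be a spacetime with a Cauchy hypersurface `S`,
`O ⊆ J⁺(S)`, and `Ψ` a late-time chart into `O` (after `τ₀`) on the boosted Kerr background
`(Λ, c, M, a)`, `0 ≤ M`, `100 M ≤ R₀`, whose truncated `Cᵏ` deviation tends to `0` on every
truncated slab. Then for every `R` there is `T` such that `dΨ_x(Λe₀)` is future-directed at every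
`x` with `T ≤ t x`, `R₀ ≤ r x ≤ R`. (Small deviation makes `dΨ(Λe₀)` uniformly timelike on late
shells, O'Neill 1983, Ch. 5, Lemma 5.26; a past sign would propagate along the coordinate ray
`x + s Λe₀`, producing a past-directed uniformly timelike ray in `O ⊆ J⁺(S)`, impossible by
`false_of_pastRay_subset_causalFuture`.) [folklore] -/
theorem exists_forall_isFutureDirected_axis (𝓢 : Spacetime.{0} 4) {S O : Set 𝓢.carrier}
    (hS : 𝓢.metric.IsCauchyHypersurface 𝓢.timeOrientation S)
    (hOS : O ⊆ 𝓢.metric.causalFuture 𝓢.timeOrientation S)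
    (hM : 0 ≤ M) {R₀ : ℝ} (h100 : 100 * M ≤ R₀) {τ₀ : ℝ}
    (Ψ : (boostedKerrBackground Λ c M a).domain → 𝓢.carrier)
    (hΨ : 𝓢.IsLateChart (boostedKerrBackground Λ c M a) O τ₀ Ψ) {k : ℕ}
    (hconv : ∀ R : ℝ, Tendsto
      (fun τ ↦ 𝓢.truncDeviationCk (boostedKerrBackground Λ c M a) Ψ k R τ) atTop (𝓝 0))
    (R : ℝ) :
    ∃ T : ℝ, ∀ x : (boostedKerrBackground Λ c M a).domain,
      T ≤ (boostedKerrBackground Λ c M a).time x.1 →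
      R₀ ≤ (boostedKerrBackground Λ c M a).radius x.1 →
      (boostedKerrBackground Λ c M a).radius x.1 ≤ R →
        𝓢.timeOrientation.IsFutureDirected
          (mfderiv 𝓘(ℝ, E4) (𝓡 4) Ψ x ((Λ : E4 ≃L[ℝ] E4) (E4.basisVector 0))) := by
  have hδpos : 0 < 1 / (20 * (‖((Λ : E4 ≃L[ℝ] E4) : E4 →L[ℝ] E4)‖ ^ 2 + 1)) := by positivity
  -- Step 1: late times with small truncated deviation on `{r ≤ R}`
  have hev : ∀ᶠ τ in atTop, 𝓢.truncDeviationCk (boostedKerrBackground Λ c M a) Ψ k R τ <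
      ENNReal.ofReal (1 / (20 * (‖((Λ : E4 ≃L[ℝ] E4) : E4 →L[ℝ] E4)‖ ^ 2 + 1))) :=
    (hconv R).eventually (gt_mem_nhds (by simpa using hδpos))
  obtain ⟨T₁, hT₁⟩ := eventually_atTop.mp hev
  refine ⟨max T₁ (τ₀ + 1), fun x hT hR₀ hR ↦ ?_⟩
  have hT₁x : T₁ ≤ (boostedKerrBackground Λ c M a).time x.1 := (le_max_left _ _).trans hT
  have hτ₀x : τ₀ + 1 ≤ (boostedKerrBackground Λ c M a).time x.1 := (le_max_right _ _).trans hT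
  -- uniform cone bound at the points `y` with `T₁ ≤ t y`, `R₀ ≤ r y ≤ R`
  have hcone : ∀ y : (boostedKerrBackground Λ c M a).domain,
      T₁ ≤ (boostedKerrBackground Λ c M a).time y.1 →
      R₀ ≤ (boostedKerrBackground Λ c M a).radius y.1 →
      (boostedKerrBackground Λ c M a).radius y.1 ≤ R →
      𝓢.metric.val (Ψ y) (mfderiv 𝓘(ℝ, E4) (𝓡 4) Ψ y ((Λ : E4 ≃L[ℝ] E4) (E4.basisVector 0)))
        (mfderiv 𝓘(ℝ, E4) (𝓡 4) Ψ y ((Λ : E4 ≃L[ℝ] E4) (E4.basisVector 0))) ≤ -(9 / 10) := by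
    intro y hy₁ hy₂ hy₃
    have hd : ‖𝓢.deviation (boostedKerrBackground Λ c M a) Ψ y‖ ≤
        1 / (20 * (‖((Λ : E4 ≃L[ℝ] E4) : E4 →L[ℝ] E4)‖ ^ 2 + 1)) :=
      norm_deviation_le_of_truncDeviationCk_le 𝓢 _ Ψ hδpos.le (hT₁ _ hy₁).le y ⟨rfl, hy₃⟩
    exact val_mfderiv_axis_le_of_norm_deviation_le 𝓢 Λ c a hM Ψ y (h100.trans hy₂) hd
  -- at `x`: timelike, hence future- or past-directed
  have hx9 := hcone x hT₁x hR₀ hR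
  have hcausal : 𝓢.metric.IsCausal
      (mfderiv 𝓘(ℝ, E4) (𝓡 4) Ψ x ((Λ : E4 ≃L[ℝ] E4) (E4.basisVector 0))) :=
    (show 𝓢.metric.IsTimelike _ from lt_of_le_of_lt hx9 (by norm_num)).isCausal
  rcases 𝓢.timeOrientation.isFutureDirected_or_isPastDirected_of_isCausal hcausal with hfut | hpast
  · exact hfut
  exfalso
  -- the coordinate ray `s ↦ x + s Λe₀` inside the domain and its lift `γ = Ψ ∘ cur`
  set cur : ℝ → (boostedKerrBackground Λ c M a).domain := fun s ↦
    ⟨x.1 + s • (Λ : E4 ≃L[ℝ] E4) (E4.basisVector 0), mem_domain_add_smul_axis Λ c M a x.2 s⟩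
    with hcur
  have hcurval : ∀ s : ℝ, (cur s : E4) = x.1 + s • (Λ : E4 ≃L[ℝ] E4) (E4.basisVector 0) :=
    fun s ↦ rfl
  have hcur0 : cur 0 = x := Subtype.ext (by simp [hcur])
  have htime : ∀ s : ℝ, (boostedKerrBackground Λ c M a).time (cur s).1 =
      (boostedKerrBackground Λ c M a).time x.1 + s := fun s ↦ time_add_smul_axis Λ c M a x.1 s
  have hrad : ∀ s : ℝ, (boostedKerrBackground Λ c M a).radius (cur s).1 =
      (boostedKerrBackground Λ c M a).radius x.1 := fun s ↦ radius_add_smul_axis Λ c M a x.1 s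
  obtain ⟨hγ, hvel⟩ := line_lift hΨ.contMDiff x.1 ((Λ : E4 ≃L[ℝ] E4) (E4.basisVector 0))
    (c := cur) hcurval
  set γ : ℝ → 𝓢.carrier := Ψ ∘ cur with hγdef
  -- speed bound along the ray for `s ≥ 0`
  have hspeed : ∀ s : ℝ, 0 ≤ s →
      𝓢.metric.val (γ s) (velocity (𝓡 4) γ s) (velocity (𝓡 4) γ s) ≤ -(9 / 10) := by
    intro s hs
    rw [(hvel s).2]
    refine hcone (cur s) ?_ ?_ ?_
    · rw [htime]; linarith
    · rw [hrad]; exact hR₀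
    · rw [hrad]; exact hR
  have htl : ∀ s : ℝ, 0 ≤ s → 𝓢.metric.IsTimelike (velocity (𝓡 4) γ s) := fun s hs ↦
    lt_of_le_of_lt (hspeed s hs) (by norm_num)
  -- the sign function `f(s) = g(T, γ')(s)` is continuous, nowhere zero on `[0, ∞)`, positive at `0`
  set f : ℝ → ℝ := fun s ↦
    𝓢.metric.val (γ s) (𝓢.timeOrientation.vectorField (γ s)) (velocity (𝓡 4) γ s) with hf
  have hcont : Continuous f :=
    (LorentzianMetric.continuous_val_snd_snd 𝓢.metric 𝓢.timeOrientation).2.comp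
      (LorentzianMetric.continuous_tangentLift (hγ.of_le one_le_infty))
  have hne : ∀ s : ℝ, 0 ≤ s → f s ≠ 0 := fun s hs ↦
    𝓢.metric.val_ne_zero_of_isTimelike_of_isCausal (𝓢.timeOrientation.isTimelike _)
      (htl s hs).isCausal
  have hf0 : 0 < f 0 := by
    have hF0 : 0 < 𝓢.metric.val (Ψ (cur 0)) (𝓢.timeOrientation.vectorField (Ψ (cur 0)))
        (mfderiv 𝓘(ℝ, E4) (𝓡 4) Ψ (cur 0) ((Λ : E4 ≃L[ℝ] E4) (E4.basisVector 0))) := by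
      rw [hcur0]
      exact hpast.2
    have e : f 0 = 𝓢.metric.val (Ψ (cur 0)) (𝓢.timeOrientation.vectorField (Ψ (cur 0)))
        (mfderiv 𝓘(ℝ, E4) (𝓡 4) Ψ (cur 0) ((Λ : E4 ≃L[ℝ] E4) (E4.basisVector 0))) := by
      simp only [hf]
      rw [(hvel 0).2]
      rfl
    rw [e]
    exact hF0
  -- hence positive on `[0, ∞)` (intermediate value theorem): the ray is past-directed throughout
  have hfpos : ∀ s : ℝ, 0 ≤ s → 0 < f s := by
    intro s hs
    by_contra hfs
    have hfs' : f s ≤ 0 := not_lt.mp hfs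
    obtain ⟨r, hr, hr0⟩ := intermediate_value_Icc' hs hcont.continuousOn ⟨hfs', hf0.le⟩
    exact hne r hr.1 hr0
  -- the ray stays in the chart image of the late region, hence in `O ⊆ J⁺(S)`
  have hmem : ∀ s : ℝ, 0 ≤ s → γ s ∈ 𝓢.metric.causalFuture 𝓢.timeOrientation S := by
    intro s hs
    have h1 : γ s ∈ Ψ '' (boostedKerrBackground Λ c M a).lateRegion τ₀ := by
      refine mem_image_of_mem Ψ ?_
      show τ₀ < (boostedKerrBackground Λ c M a).time (cur s).1
      rw [htime]
      linarith
    exact hOS (hΨ.image_subset h1)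
  -- contradiction
  have hray : ∀ s : ℝ, 0 ≤ s → MDifferentiableAt 𝓘(ℝ, ℝ) (𝓡 4) γ s ∧
      𝓢.metric.val (γ s) (velocity (𝓡 4) γ s) (velocity (𝓡 4) γ s) ≤ -(9 / 10) ∧
      𝓢.timeOrientation.IsPastDirected (velocity (𝓡 4) γ s) := fun s hs ↦
    ⟨(hvel s).1, hspeed s hs, (htl s hs).isCausal, hfpos s hs⟩
  have h910 : (0 : ℝ) < 9 / 10 := by norm_num
  exact false_of_pastRay_subset_causalFuture (g := 𝓢.metric) (τ := 𝓢.timeOrientation) (γ := γ)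
    two_le_infty hS h910 hray hmem

end Chart

/-! ## The registered stub -/

/-- **Registered stub S2** (`stub_orientationAnchor : OrientationAnchorHolds`): the orientation anchor
of the input hole charts of a `C⁴` final-state decomposition of `O = exteriorOf 𝒟 d.charted =
J⁺(ι X) ∩ I⁻(d.charted)` with `HonestCore(d, R₀)` — `exists_forall_isFutureDirected_axis` for the
chart of hole `i` (a late chart into `O ⊆ J⁺(ι X)`, `ι X` a Cauchy hypersurface of the development),
fed by `HonestCore` (a) (`100 Mᵢ ≤ R₀`), `0 < Mᵢ` and the structure's fixed-radius `C⁴` convergence.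
O'Neill 1983, Ch. 5, Lemma 5.26 and Ch. 14, Lemma 14.29. [folklore] -/
theorem stub_orientationAnchor : OrientationAnchorHolds := by
  intro X _ _ _ _ D _ 𝒟 _ O d R₀ hO hc i R
  obtain ⟨ha, -, -, -⟩ := hc
  have hOS : O ⊆ 𝒟.metric.causalFuture 𝒟.timeOrientation (range 𝒟.embed) := by
    rw [hO]
    exact inter_subset_left
  exact exists_forall_isFutureDirected_axis (d.motion i).1 (d.motion i).2 (d.mass i) (d.spin i)
    𝒟.toSpacetime 𝒟.isCauchyHypersurface hOS (d.mass_pos i).le (ha i).2.1 (d.chart i)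
    (d.isLateChart i) (d.tendsto_truncDeviationCk i) R

end Summit.FinalStateConjecture.FinalStateConjecture.Theorems.NeckGapDecay.ConnectionLevelCones.OrientationAnchorStub

end
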